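import Summits.QuantumFields.YangMills.Theorems.TubeZeroFreeChannel.Negative.AxisBlocking
import Literature.MathematicalPhysics.QuantumFieldTheory.WilsonFinTorusPartitionComplex
import HarnessLib

/-!
# The tube rate at real coupling: `(L³ t)⁻¹ log Z(x; L, t) → log λ₊(x, L) / L³`

Helper file for the crux `TubeZeroFreeChannel` (item `stmt-QuantumFields-18841`, route
`ComplexCouplingChannel` of `QuantumFields/YangMills`), line `legendre-capped-pocket`, stub W1
(`stub_tubeRate`): real-coupling transfer-matrix bookkeeping.

For every compact gauge group `G` with a faithful continuous unitary lattice representation `r`, every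
real coupling `x ≥ 0` and every cross-section `L ≥ 1`, the TUBE RATE of the crux's box partition function
`boxZ r x L t` (the complex-coupling Wilson partition function of the periodic box `L³ × t`) exists:
`(L³ t)⁻¹ log ‖Z(x; L, t)‖ → log λ₊(x, L) / L³` as `t → ∞`, where
`λ₊ = transferSpectralRadius r.ρ x L > 0` is the principal growth rate (top eigenvalue) of the transfer
matrix on the spatial torus `(ℤ/L)³`.

Proof.
* Dictionary (`boxZ_ofReal_eq_wilsonFinTorusPartition`): `boxZ r x L t` is, definitionally, the complex
  partition function `wilsonFinTorusPartitionC r.ρ x L L L t`, which at real coupling is the real (positive)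
  `wilsonFinTorusPartition r.ρ x L L L t` (`wilsonFinTorusPartitionC_ofReal`, `wilsonFinTorusPartition_pos`).
* Trace formula (`exists_spectralData_wilsonFinTorusPartition`, second countability of `G` from the
  faithful `r`): `Z(L³ × (m+2)) = Σᵢ λᵢ^{m+2}` with `0 ≤ λᵢ ≤ λ_{i₀} = λ₊`, `0 < λ₊`, `Σ λᵢ² < ∞`.
* Elementary squeeze (`tendsto_log_div_of_hasSum_pow`): `λ₊^{m+2} ≤ Z(m+2) ≤ λ₊^m Σᵢ λᵢ²`, so
  `(m+2) log λ₊ ≤ log Z(m+2) ≤ m log λ₊ + log Σᵢ λᵢ²` and `t⁻¹ log Z(t) → log λ₊`; divide by `L³`.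

References: I. Montvay, G. Münster, *Quantum Fields on a Lattice* (1994) §3.2.6 (3.145) (`Z = Tr Tⁿ`);
M. Lüscher, Commun. Math. Phys. 54 (1977) 283 (the transfer matrix).  Everything below is standard and tagged
folklore.
-/

set_option autoImplicit false

noncomputable section

open scoped Topology
open Filter MeasureTheory
open Literature.MathematicalPhysics.QuantumFieldTheory (LatticeRep transferSpectralRadius
  wilsonFinTorusPartition wilsonFinTorusPartitionC wilsonFinTorusPartitionC_ofReal
  wilsonFinTorusPartition_pos exists_spectralData_wilsonFinTorusPartition)
open Summit.QuantumFields.YangMills.Theorems.TubeZeroFreeChannel.Negative (boxZ)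

namespace Summit.QuantumFields.YangMills.Theorems.TubeZeroFreeChannel

/-! ### The elementary squeeze -/

/-- **Growth rate of spectral sums, logarithmic form.**  If `Z (m+2) = Σᵢ λᵢ^{m+2}` for all `m`, with
`0 ≤ λᵢ ≤ λ_{i₀}`, `0 < λ_{i₀}` and `Σ λᵢ² < ∞`, then `λ_{i₀}^{m+2} ≤ Z (m+2) ≤ λ_{i₀}^m Σᵢ λᵢ²`, hence
`t⁻¹ log Z(t) → log λ_{i₀}` as `t → ∞`. [folklore] -/
theorem tendsto_log_div_of_hasSum_pow {ι : Type*} {lam : ι → ℝ} {i₀ : ι}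
    (hle : ∀ i, 0 ≤ lam i ∧ lam i ≤ lam i₀) (hL0 : 0 < lam i₀) (hS : Summable fun i => lam i ^ 2)
    {Z : ℕ → ℝ} (hZ : ∀ m : ℕ, HasSum (fun i => lam i ^ (m + 2)) (Z (m + 2))) :
    Tendsto (fun t : ℕ => Real.log (Z t) / (t : ℝ)) atTop (𝓝 (Real.log (lam i₀))) := by
  set Λ := lam i₀ with hΛ
  set S := ∑' i, lam i ^ 2 with hSdef
  have hS2 : HasSum (fun i => lam i ^ 2) S := hS.hasSum
  have hSL : Λ ^ 2 ≤ S := le_hasSum hS2 i₀ fun j _ => sq_nonneg _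
  have hS0 : 0 < S := lt_of_lt_of_le (pow_pos hL0 2) hSL
  -- two-sided bounds `Λ^{m+2} ≤ Z(m+2) ≤ Λ^m S`
  have hlow : ∀ m, Λ ^ (m + 2) ≤ Z (m + 2) := fun m =>
    le_hasSum (hZ m) i₀ fun j _ => pow_nonneg (hle j).1 _
  have hup : ∀ m, Z (m + 2) ≤ Λ ^ m * S := fun m =>
    hasSum_le (fun i => by
      rw [pow_add]
      exact mul_le_mul_of_nonneg_right (pow_le_pow_left₀ (hle i).1 (hle i).2 m) (sq_nonneg _))
      (hZ m) (hS2.mul_left (Λ ^ m))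
  have hZ0 : ∀ m, 0 < Z (m + 2) := fun m => (pow_pos hL0 _).trans_le (hlow m)
  -- their logarithms
  have hlogl : ∀ m : ℕ, ((m : ℝ) + 2) * Real.log Λ ≤ Real.log (Z (m + 2)) := fun m => by
    have h := Real.log_le_log (pow_pos hL0 _) (hlow m)
    rw [Real.log_pow] at h
    push_cast at h
    exact h
  have hlogu : ∀ m : ℕ, Real.log (Z (m + 2)) ≤ (m : ℝ) * Real.log Λ + Real.log S := fun m => by
    have h := Real.log_le_log (hZ0 m) (hup m)
    rw [Real.log_mul (pow_pos hL0 _).ne' hS0.ne', Real.log_pow] at h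
    exact h
  have hpos : ∀ m : ℕ, (0 : ℝ) < (m : ℝ) + 2 := fun m => by positivity
  -- the upper comparison sequence `(m log Λ + log S)/(m+2) = log Λ + (log S − 2 log Λ)/(m+2) → log Λ`
  have h1 : Tendsto (fun m : ℕ => (Real.log S - 2 * Real.log Λ) / ((m : ℝ) + 2)) atTop (𝓝 0) :=
    tendsto_const_nhds.div_atTop (tendsto_atTop_add_const_right _ _ tendsto_natCast_atTop_atTop)
  have hupper : Tendsto (fun m : ℕ => ((m : ℝ) * Real.log Λ + Real.log S) / ((m : ℝ) + 2)) atTop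
      (𝓝 (Real.log Λ)) := by
    have h := (tendsto_const_nhds (x := Real.log Λ)).add h1
    rw [add_zero] at h
    refine h.congr fun m => ?_
    have hm := (hpos m).ne'
    field_simp
    ring
  have hmain : Tendsto (fun m : ℕ => Real.log (Z (m + 2)) / ((m : ℝ) + 2)) atTop (𝓝 (Real.log Λ)) := by
    refine tendsto_of_tendsto_of_tendsto_of_le_of_le tendsto_const_nhds hupper (fun m => ?_) fun m => ?_
    · show Real.log Λ ≤ Real.log (Z (m + 2)) / ((m : ℝ) + 2)
      rw [le_div_iff₀ (hpos m), mul_comm]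
      exact hlogl m
    · show Real.log (Z (m + 2)) / ((m : ℝ) + 2) ≤ ((m : ℝ) * Real.log Λ + Real.log S) / ((m : ℝ) + 2)
      exact div_le_div_of_nonneg_right (hlogu m) (hpos m).le
  refine (tendsto_add_atTop_iff_nat 2).1 (hmain.congr fun m => ?_)
  push_cast
  rfl

/-! ### The dictionary at real coupling -/

variable {G : Type} [Group G] [TopologicalSpace G] [IsTopologicalGroup G] [CompactSpace G]
  [MeasurableSpace G] [BorelSpace G]

/-- **Dictionary**: at a real coupling `x` the crux's box partition function `boxZ r x L t` is the real
Wilson partition function `wilsonFinTorusPartition r.ρ x L L L t` of the `Fin`-torus `L³ × t` (`boxZ` is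
definitionally `wilsonFinTorusPartitionC r.ρ · L L L t`, `wilsonFinTorusPartitionC_ofReal`). [folklore] -/
theorem boxZ_ofReal_eq_wilsonFinTorusPartition (r : LatticeRep G) (x : ℝ) (L t : ℕ) :
    boxZ r (x : ℂ) L t = ((wilsonFinTorusPartition r.ρ x L L L t : ℝ) : ℂ) := by
  show wilsonFinTorusPartitionC r.ρ (x : ℂ) L L L t = _
  exact wilsonFinTorusPartitionC_ofReal r.ρ x L L L t

/-- **The modulus of the box partition function at real coupling** is the (positive) real Wilson partition
function: `‖boxZ r x L t‖ = wilsonFinTorusPartition r.ρ x L L L t`. [folklore] -/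
theorem norm_boxZ_ofReal (r : LatticeRep G) (x : ℝ) (L t : ℕ) :
    ‖boxZ r (x : ℂ) L t‖ = wilsonFinTorusPartition r.ρ x L L L t := by
  haveI : SecondCountableTopology G :=
    (r.continuous.isClosedEmbedding r.injective).isEmbedding.secondCountableTopology
  rw [boxZ_ofReal_eq_wilsonFinTorusPartition, Complex.norm_real, Real.norm_eq_abs,
    abs_of_pos (wilsonFinTorusPartition_pos r.continuous x L L L t)]

/-! ### The stub -/

/-- **STUB W1 `stub_tubeRate` (line `legendre-capped-pocket` of crux `TubeZeroFreeChannel`): the tube rate at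
real coupling.**  For every compact group `G` with a faithful continuous unitary lattice representation `r`,
every real coupling `x ≥ 0` and every cross-section `L ≥ 1`,
`(L³ t)⁻¹ log ‖boxZ r x L t‖ → log (transferSpectralRadius r.ρ x L) / L³` as `t → ∞`: by the trace formula
`Z(L³ × (m+2)) = Σᵢ λᵢ^{m+2}` (`exists_spectralData_wilsonFinTorusPartition`; second countability of `G` from
the faithful `r`) and the squeeze `λ₊^{m+2} ≤ Z ≤ λ₊^m Σᵢ λᵢ²` (`tendsto_log_div_of_hasSum_pow`), with
`λ₊ = λ_{i₀} = transferSpectralRadius r.ρ x L`. [folklore] -/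
theorem stub_tubeRate {G : Type} [Group G] [TopologicalSpace G] [IsTopologicalGroup G] [CompactSpace G]
    [MeasurableSpace G] [BorelSpace G] (r : LatticeRep G) (x : ℝ) (hx : 0 ≤ x) (L : ℕ) [NeZero L] :
    Tendsto (fun t : ℕ => Real.log ‖boxZ r (x : ℂ) L t‖ / ((L : ℝ) ^ 3 * t)) atTop
      (𝓝 (Real.log (transferSpectralRadius r.ρ x L) / (L : ℝ) ^ 3)) := by
  haveI : SecondCountableTopology G :=
    (r.continuous.isClosedEmbedding r.injective).isEmbedding.secondCountableTopology
  obtain ⟨s, _, b, lam, i₀, -, hle, hL0, -, hS, hrad, hZ⟩ :=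
    exists_spectralData_wilsonFinTorusPartition r.continuous r.mem_unitary hx L
  have h := (tendsto_log_div_of_hasSum_pow hle hL0 hS hZ).div_const ((L : ℝ) ^ 3)
  rw [hrad]
  refine h.congr fun t => ?_
  rw [norm_boxZ_ofReal, div_div, mul_comm]

end Summit.QuantumFields.YangMills.Theorems.TubeZeroFreeChannel

end
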